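import Summits.MatrixMultiplication.OmegaCensus.STPPKneserFilter

/-!
# ω-census (abelian STPP census): filter N14 — the BLOCK VOLUME LAW (kernel)

HONEST FRAMING (pub-omega census; verbatim): lottery ticket; floor = certified bounds/negative ranges.
Census BOOKKEEPING / STRUCTURE (seat pub-omega-stpp-1 gen 27, 2026-08-27), family (b2).  A necessary condition on STPP families in finite
abelian groups — a tool for EXCLUDING candidate block patterns by theorem; nothing here is progress on `ω`.

## Statement

Let `(Aᵢ, Bᵢ, Cᵢ)_{i<N}` be an STPP family (CKSU 2005 Def. 5.1, one-clause form, the tree's `IsSTPP`) with non-empty sets in a finite abelian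
group `H`, `|H| = n`, card vectors `aᵢ = |Aᵢ|`, `bᵢ = |Bᵢ|`, `cᵢ = |Cᵢ|`; `X_k = B_k − A_k`, `Y_k = C_k − B_k`, `Z_k = C_k − A_k`
(`STPPKneserFilter.lean` §2: `D A B`, `D B C`, `D A C`, pairwise disjoint families of sizes `a_k b_k`, `b_k c_k`, `a_k c_k`).

**Filter N14 (block volume law).**  For EVERY block `i`:
`aᵢbᵢcᵢ + Σ_{k ≠ i} a_k c_k ≤ n`,  `aᵢbᵢcᵢ + Σ_{k ≠ i} a_k b_k ≤ n`,  `aᵢbᵢcᵢ + Σ_{k ≠ i} b_k c_k ≤ n`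
(`vol_add_sum_erase_AC_le` / `_AB_le` / `_BC_le`; decidable card-vector predicate `N14Dead` with `not_isSTPP_of_n14Dead`, same shape as
`N8Dead` … `N13Dead`).  No divisor quantifier, no Kneser, five lines.

PROOF (`vol_add_sum_erase_AC_le`).  Def. 5.1 (ii) says `x + y = z` with `x ∈ Xᵢ`, `y ∈ Y_j`, `z ∈ Z_k` only if `i = j = k`; hence `Xᵢ + Yᵢ` is
disjoint from `Z_k` for every `k ≠ i`.  Fix `t₀ ∈ Bᵢ`.  The set `E = {t₀ + c − a − b : a ∈ Aᵢ, b ∈ Bᵢ, c ∈ Cᵢ} = (t₀ − Aᵢ) + (Cᵢ − Bᵢ) ⊆ Xᵢ + Yᵢ`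
has EXACTLY `aᵢbᵢcᵢ` elements, because `(a, b, c) ↦ t₀ + c − a − b` is injective by the triple product property of block `i` (pattern `(i,i,i)`),
and it is disjoint from `⋃_{k ≠ i} Z_k`, a disjoint union of `Σ_{k≠i} a_k c_k` elements (pattern `(i,i,k)` of Def. 5.1 with the witnesses
`s = a' ∈ A_k`, `s' = a`, `t = t₀`, `t' = b`, `u = c`, `u' = c' ∈ C_k`).  Both live in `H`.  The other two lines are the same statement for the
rotated families `(B, C, A)` and `(C, A, B)` (`stpp_rotate`).

WHY IT IS NEW TO THE CENSUS.  The case `N = 1` is N1-abelian (`abc ≤ n`, `STPPSumsetPacking.lean`); the packing filters N3/N5 and the Kneser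
filters N8/N9 (inclusion K1a: `X + ⋃_{k≠j} Y_k ⊆ H ∖ Z_j`) bound `|Xᵢ + Yᵢ|` from below only by SUMS of two pair-products (`aᵢbᵢ + bᵢcᵢ − d`), never
by the VOLUME `aᵢbᵢcᵢ` of the block; for a fat block of volume close to `n` the volume is the larger number by far.

**Corollary (`sum_vol_le_card_of_thin`, STRUCTURE Q-class): if every block except possibly one has `|A_k| = 1`, the family never beats the sum
of cubes: `Σ_k a_k b_k c_k ≤ |H|`** (the `bc`-reading at the exceptional block; by the rotations also with `|B_k| = 1` or `|C_k| = 1` throughout).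

## Application: the last three ℤ₅₇ endgame leaves (§3)

The census endgame of the cyclic group of order 57 (stpp-2 kit GO #47 `parts-57d`, 29 tier-L leaves) left exactly three leaves undecided by every
theorem filter N7–N13: `{(1,1,4),(3,3,6)}`, `{(1,1,13),(3,3,5)}`, `{(1,1,1)⁴,(3,3,6)}` (one fat `(3,3,c)` block of volume `54` or `45` plus `A`-thin
blocks).  All three are N14-dead in ANY abelian group of order 57: `54 + 4`, `45 + 13`, `54 + 1+1+1+1` all equal `58 > 57`
(`no_isSTPP_Z57_114_336`, `no_isSTPP_Z57_11d_335`, `no_isSTPP_Z57_111_111_111_111_336`; one base-36 digit per set size, `d = 13`).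

Measured bite (HOME `pub-omega-stpp-1-g27/n14/`, numbers only): tier-L 29 of GO #47: 13 N14-dead (with N10–N13: 29/29 theorem-dead); ℤ₅₇ front of
record 820: alive under N10–N14 = 81 (84 under N10–N13); engine records (17 abelian logs, orders 48–57): 530 of 5 588 distinct UNSAT patterns and
247 of 4 025 cores are N14-dead; SOUNDNESS of the arithmetic: 0 of 568 FEASIBLE pairs (abelian `≤ 16`) and 0 of 1 984 SAT-witnessed patterns flagged.

References: H. Cohn, R. Kleinberg, B. Szegedy, C. Umans, FOCS 2005 (arXiv:math/0511460), Def. 5.1; H. Cohn, C. Umans, FOCS 2003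
(arXiv:math/0307321), Lemma 2.x (the abelian injectivity argument, case `N = 1`).
-/

open Finset
open scoped Pointwise

namespace Summit.MatrixMultiplication.OmegaCensus.CubeNB

open Literature.Computability.AlgebraicComplexity
open Summit.MatrixMultiplication.OmegaCensus.STPPKneser

variable {H : Type*} [AddCommGroup H] [DecidableEq H] [Fintype H] {N : ℕ} {A B C : Fin N → Finset H}

/-! ## §1 The block volume law -/

section Law

omit [Fintype H] in
/-- The translated block sumset `E = {t₀ + c − a − b : (a, b, c) ∈ Aᵢ × Bᵢ × Cᵢ} = (t₀ − Aᵢ) + (Cᵢ − Bᵢ) ⊆ Xᵢ + Yᵢ` has exactly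
`|Aᵢ||Bᵢ||Cᵢ|` elements: `(a, b, c) ↦ t₀ + c − a − b` is injective by the triple product property of block `i` (pattern `(i,i,i)` of Def. 5.1).
[cite: CohnKleinbergSzegedyUmans2005, Def. 5.1] -/
theorem card_image_blockSum (hS : IsSTPP A B C) (i : Fin N) (t₀ : H) :
    #(((A i) ×ˢ ((B i) ×ˢ (C i))).image fun q : H × H × H => t₀ + q.2.2 - q.1 - q.2.1) = #(A i) * #(B i) * #(C i) := by
  rw [Finset.card_image_of_injOn, Finset.card_product, Finset.card_product, mul_assoc]
  rintro ⟨a, b, c⟩ hq ⟨a', b', c'⟩ hq' (heq : t₀ + c - a - b = t₀ + c' - a' - b')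
  simp only [Finset.coe_product, Set.mem_prod, Finset.mem_coe] at hq hq'
  have hrel : (a' - a) + (b' - b) + (c - c') = 0 := by
    have h' := sub_eq_zero.2 heq
    rw [← h']; abel
  obtain ⟨-, -, h1, h2, h3⟩ := hS i i i a hq.1 a' hq'.1 b hq.2.1 b' hq'.2.1 c' hq'.2.2 c hq.2.2 hrel
  rw [h1, h2, h3]

omit [Fintype H] in
/-- The translated block sumset `E` of block `i` misses every `Z_k = C_k − A_k` with `k ≠ i`: `t₀ + c − a − b = c' − a'` (`a' ∈ A_k`, `c' ∈ C_k`)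
is the Def-5.1 relation `(a − a') + (b − t₀) + (c' − c) = 0` of index pattern `(i, i, k)`, forcing `k = i`.
[cite: CohnKleinbergSzegedyUmans2005, Def. 5.1] -/
theorem disjoint_image_blockSum_DU (hS : IsSTPP A B C) (i : Fin N) {t₀ : H} (ht₀ : t₀ ∈ B i) :
    Disjoint (((A i) ×ˢ ((B i) ×ˢ (C i))).image fun q : H × H × H => t₀ + q.2.2 - q.1 - q.2.1) (DU A C (univ.erase i)) := by
  rw [Finset.disjoint_left]
  intro w hw hw'
  obtain ⟨⟨a, b, c⟩, hq, rfl⟩ := Finset.mem_image.1 hw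
  simp only [Finset.mem_product] at hq
  obtain ⟨k, hk, hz⟩ := Finset.mem_biUnion.1 hw'
  obtain ⟨a', ha', c', hc', hz⟩ := mem_D.1 hz
  have hrel : (a - a') + (b - t₀) + (c' - c) = 0 := by
    have h' := sub_eq_zero.2 hz
    rw [← h']; abel
  obtain ⟨-, hik, -, -, -⟩ := hS i i k a' ha' a hq.1 t₀ ht₀ b hq.2.1 c hq.2.2 c' hc' hrel
  exact (Finset.mem_erase.1 hk).1 hik.symm

/-- **N14, `AC`-reading.**  For an STPP family with non-empty `B`-sets in a finite abelian group and every block `i`: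
`|Aᵢ||Bᵢ||Cᵢ| + Σ_{k ≠ i} |A_k||C_k| ≤ |H|` — the translated block sumset (`|Aᵢ||Bᵢ||Cᵢ|` points) and `⋃_{k≠i} Z_k` (`Σ_{k≠i} |A_k||C_k|` points,
a disjoint union) are disjoint subsets of `H`. [cite: CohnKleinbergSzegedyUmans2005, Def. 5.1] -/
theorem vol_add_sum_erase_AC_le (hS : IsSTPP A B C) (hB : ∀ i, (B i).Nonempty) (i : Fin N) :
    #(A i) * #(B i) * #(C i) + ∑ k ∈ univ.erase i, #(A k) * #(C k) ≤ Fintype.card H := by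
  obtain ⟨t₀, ht₀⟩ := hB i
  rw [← card_image_blockSum hS i t₀, ← card_DU_AC hS hB (univ.erase i),
    ← Finset.card_union_of_disjoint (disjoint_image_blockSum_DU hS i ht₀)]
  exact Finset.card_le_univ _

/-- **N14, `AB`-reading** (the law for the rotated family `(B, C, A)`): `|Aᵢ||Bᵢ||Cᵢ| + Σ_{k ≠ i} |A_k||B_k| ≤ |H|` (needs non-empty `C`-sets).
[cite: CohnKleinbergSzegedyUmans2005, Def. 5.1] -/
theorem vol_add_sum_erase_AB_le (hS : IsSTPP A B C) (hC : ∀ i, (C i).Nonempty) (i : Fin N) :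
    #(A i) * #(B i) * #(C i) + ∑ k ∈ univ.erase i, #(A k) * #(B k) ≤ Fintype.card H := by
  have h := vol_add_sum_erase_AC_le (stpp_rotate hS) hC i
  have e1 : #(B i) * #(C i) * #(A i) = #(A i) * #(B i) * #(C i) := by ring
  have e2 : ∑ k ∈ univ.erase i, #(B k) * #(A k) = ∑ k ∈ univ.erase i, #(A k) * #(B k) :=
    Finset.sum_congr rfl fun k _ => mul_comm _ _
  rw [e1, e2] at h
  exact h

/-- **N14, `BC`-reading** (the law for the rotated family `(C, A, B)`): `|Aᵢ||Bᵢ||Cᵢ| + Σ_{k ≠ i} |B_k||C_k| ≤ |H|` (needs non-empty `A`-sets).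
[cite: CohnKleinbergSzegedyUmans2005, Def. 5.1] -/
theorem vol_add_sum_erase_BC_le (hS : IsSTPP A B C) (hA : ∀ i, (A i).Nonempty) (i : Fin N) :
    #(A i) * #(B i) * #(C i) + ∑ k ∈ univ.erase i, #(B k) * #(C k) ≤ Fintype.card H := by
  have h := vol_add_sum_erase_AC_le (stpp_rotate (stpp_rotate hS)) hA i
  have e1 : #(C i) * #(A i) * #(B i) = #(A i) * #(B i) * #(C i) := by ring
  have e2 : ∑ k ∈ univ.erase i, #(C k) * #(B k) = ∑ k ∈ univ.erase i, #(B k) * #(C k) :=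
    Finset.sum_congr rfl fun k _ => mul_comm _ _
  rw [e1, e2] at h
  exact h

/-- **Corollary: `A`-thin companions never make a block beat.**  If `|A_k| = 1` for every block `k ≠ i` (block `i` arbitrary) and the `A`-sets
are non-empty, then `Σ_k |A_k||B_k||C_k| ≤ |H|` — such a family never beats the sum of cubes (the `BC`-reading at `i`, where each companion's
volume is `b_k c_k`).  By the rotations the same holds with `|B_k| = 1` (all `k ≠ i`) or `|C_k| = 1` (all `k ≠ i`).
[cite: CohnKleinbergSzegedyUmans2005, Def. 5.1] -/
theorem sum_vol_le_card_of_thin (hS : IsSTPP A B C) (hA : ∀ i, (A i).Nonempty) (i : Fin N)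
    (hthin : ∀ k, k ≠ i → #(A k) = 1) : ∑ k, #(A k) * #(B k) * #(C k) ≤ Fintype.card H := by
  have h := vol_add_sum_erase_BC_le hS hA i
  have e : ∑ k ∈ univ.erase i, #(B k) * #(C k) = ∑ k ∈ univ.erase i, #(A k) * #(B k) * #(C k) :=
    Finset.sum_congr rfl fun k hk => by rw [hthin k (Finset.mem_erase.1 hk).1, one_mul]
  rw [e] at h
  calc ∑ k, #(A k) * #(B k) * #(C k)
      = #(A i) * #(B i) * #(C i) + ∑ k ∈ univ.erase i, #(A k) * #(B k) * #(C k) :=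
        (Finset.add_sum_erase _ _ (mem_univ i)).symm
    _ ≤ Fintype.card H := h

end Law

/-! ## §2 The decidable card-vector predicate and the filter theorem -/

section Filter

/-- **Filter N14, one reading**, on the card vectors `(a, b, c)` of a pattern in a group of order `n`: some block `i` has
`aᵢbᵢcᵢ + Σ_{k≠i} a_k c_k > n`.  Same verdicts as HOME `pub-omega-stpp-1-g27/code/n14_filter.py` (`'ca'` reading). [folklore] -/
def N14Dead1 (n N : ℕ) (a b c : Fin N → ℕ) : Bool :=
  decide (∃ i : Fin N, n < a i * b i * c i + ∑ k ∈ univ.erase i, a k * c k)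

/-- **Filter N14** on the card vectors: `N14Dead1` for one of the three rotations `(a,b,c)`, `(b,c,a)`, `(c,a,b)` — i.e. the `AC`-, `AB`- and
`BC`-readings of the block volume law.  Invariant under the simultaneous role permutations of the census. [folklore] -/
def N14Dead (n N : ℕ) (a b c : Fin N → ℕ) : Bool := N14Dead1 n N a b c || N14Dead1 n N b c a || N14Dead1 n N c a b

/-- **Filter N14, one reading (kernel).**  An STPP family with non-empty `B`-sets whose card vectors satisfy `N14Dead1 |H|` does not exist.
[cite: CohnKleinbergSzegedyUmans2005, Def. 5.1] -/
theorem not_isSTPP_of_n14Dead1 (hS : IsSTPP A B C) (hB : ∀ i, (B i).Nonempty) {n : ℕ} (hn : Fintype.card H = n)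
    {a b c : Fin N → ℕ} (ha : ∀ i, #(A i) = a i) (hb : ∀ i, #(B i) = b i) (hc : ∀ i, #(C i) = c i)
    (hdead : N14Dead1 n N a b c = true) : False := by
  obtain ⟨i, hlt⟩ := of_decide_eq_true hdead
  have h := vol_add_sum_erase_AC_le hS hB i
  rw [hn, ha, hb, hc] at h
  have e : ∑ k ∈ univ.erase i, #(A k) * #(C k) = ∑ k ∈ univ.erase i, a k * c k :=
    Finset.sum_congr rfl fun k _ => by rw [ha, hc]
  rw [e] at h
  omega

/-- **Filter N14 (kernel): an STPP family with non-empty sets in a finite abelian group `H` whose pattern `(|Aᵢ|,|Bᵢ|,|Cᵢ|)ᵢ` is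
`N14Dead |H|` does not exist** — the three readings via `stpp_rotate`. [cite: CohnKleinbergSzegedyUmans2005, Def. 5.1] -/
theorem not_isSTPP_of_n14Dead (hS : IsSTPP A B C) (hA : ∀ i, (A i).Nonempty) (hB : ∀ i, (B i).Nonempty)
    (hC : ∀ i, (C i).Nonempty) {n : ℕ} (hn : Fintype.card H = n) {a b c : Fin N → ℕ} (ha : ∀ i, #(A i) = a i)
    (hb : ∀ i, #(B i) = b i) (hc : ∀ i, #(C i) = c i) (hdead : N14Dead n N a b c = true) : False := by
  simp only [N14Dead, Bool.or_eq_true] at hdead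
  rcases hdead with (h | h) | h
  · exact not_isSTPP_of_n14Dead1 hS hB hn ha hb hc h
  · exact not_isSTPP_of_n14Dead1 (stpp_rotate hS) hC hn hb hc ha h
  · exact not_isSTPP_of_n14Dead1 (stpp_rotate (stpp_rotate hS)) hA hn hc ha hb h

/-- Card-vector form with literal vectors: non-emptiness from positivity of the entries. [cite: CohnKleinbergSzegedyUmans2005, Def. 5.1] -/
theorem not_isSTPP_of_n14Dead' (hS : IsSTPP A B C) {n : ℕ} (hn : Fintype.card H = n) (a b c : Fin N → ℕ)
    (ha : ∀ i, #(A i) = a i) (hb : ∀ i, #(B i) = b i) (hc : ∀ i, #(C i) = c i)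
    (hpos : ∀ i, 0 < a i ∧ 0 < b i ∧ 0 < c i) (hdead : N14Dead n N a b c = true) : False :=
  not_isSTPP_of_n14Dead hS (fun i => card_pos.1 ((ha i).symm ▸ (hpos i).1))
    (fun i => card_pos.1 ((hb i).symm ▸ (hpos i).2.1)) (fun i => card_pos.1 ((hc i).symm ▸ (hpos i).2.2))
    hn ha hb hc hdead

end Filter

/-! ## §3 The last three ℤ₅₇ endgame leaves -/

section Examples

/-- The ℤ₅₇ endgame leaf `{(1,1,4), (3,3,6)}` (`Σ abc = 58 > 57`; alive under every filter N7–N13) carries no STPP family in ANY abelian group of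
order `57`: N14 at the fat block, `AC`-reading, `54 + 1·4 = 58 > 57`. [cite: CohnKleinbergSzegedyUmans2005, Def. 5.1] -/
theorem no_isSTPP_Z57_114_336 (hH : Fintype.card H = 57) (A B C : Fin 2 → Finset H) (hS : IsSTPP A B C)
    (hA : ∀ i, #(A i) = ![1, 3] i) (hB : ∀ i, #(B i) = ![1, 3] i) (hC : ∀ i, #(C i) = ![4, 6] i) : False :=
  not_isSTPP_of_n14Dead' hS hH _ _ _ hA hB hC (by decide) (by decide +kernel)

/-- The ℤ₅₇ endgame leaf `{(1,1,13), (3,3,5)}` (`Σ abc = 58 > 57`; alive under every filter N7–N13) carries no STPP family in any abelian group of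
order `57`: N14 at the fat block, `AC`-reading, `45 + 1·13 = 58 > 57`. [cite: CohnKleinbergSzegedyUmans2005, Def. 5.1] -/
theorem no_isSTPP_Z57_11d_335 (hH : Fintype.card H = 57) (A B C : Fin 2 → Finset H) (hS : IsSTPP A B C)
    (hA : ∀ i, #(A i) = ![1, 3] i) (hB : ∀ i, #(B i) = ![1, 3] i) (hC : ∀ i, #(C i) = ![13, 5] i) : False :=
  not_isSTPP_of_n14Dead' hS hH _ _ _ hA hB hC (by decide) (by decide +kernel)

/-- The ℤ₅₇ endgame leaf `{(1,1,1)⁴, (3,3,6)}` (`Σ abc = 58 > 57`; four singleton blocks next to a fat `(3,3,6)` block; alive under every filter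
N7–N13) carries no STPP family in any abelian group of order `57`: N14 at the fat block, `54 + 1+1+1+1 = 58 > 57` — the four differences
`αₖ − γₖ` of the singleton blocks are pairwise distinct and all avoid the 54-point translated block sumset. [cite: CohnKleinbergSzegedyUmans2005, Def. 5.1] -/
theorem no_isSTPP_Z57_111_111_111_111_336 (hH : Fintype.card H = 57) (A B C : Fin 5 → Finset H) (hS : IsSTPP A B C)
    (hA : ∀ i, #(A i) = ![1, 1, 1, 1, 3] i) (hB : ∀ i, #(B i) = ![1, 1, 1, 1, 3] i)
    (hC : ∀ i, #(C i) = ![1, 1, 1, 1, 6] i) : False :=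
  not_isSTPP_of_n14Dead' hS hH _ _ _ hA hB hC (by decide) (by decide +kernel)

end Examples

end Summit.MatrixMultiplication.OmegaCensus.CubeNB
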